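import Mathlib
import Summits.NavierStokesRegularity.NavierStokesRegularity.Theorems.EulerZoomLiouvillePowerGaugeEulerLiouvilleSmallMomentLimit
import HarnessLib

/-!
# t56-SM, steps 3–4 (tools): THE SCALE DERIVATIVE OF THE CUT-OFF MOMENT and THE STRETCHING / DRIFT BOUNDS
# (nsreg-p2 ROUND-52 §E `NsregP2.R52.Provenance.SmallMomentLaw ρ V`, r52/Sketch52E.lean 71b4a3bde833b3de l.76–82, VERBATIM unfolded;
# key 06:31:13Z; ezl-w3 g7 feasibility note `ns-ezl-w3-t56-SM-feasibility-g7.md` fd09e649b512eb91, steps 3–5;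
# seat ns-sfl-p1 g9, `--supports stmt-NavierStokesRegularity-19832 --as helper`)

* `hasDerivAt_moment` — `d/ds ∫ σ(2 − ‖y‖²/s²) f = ∫ σ′(2 − ‖y‖²/s²)(2‖y‖²/s³) f` for continuous `f` (differentiation under the integral,
  `hasDerivAt_integral_of_dominated_loc_of_deriv_le`); `scale_mul_deriv_moment_eq` — its flux form `s·M′ = ∫ 2s⁻²σ′‖y‖² f`.
* `stretch_bound` — `∫|ψ_s(‖Ω‖²)^{p−1}⟪Ω,DVΩ⟫| ≤ √(K₁(3s)^{x₁})·√((3s)^{1−ρ}E_w)` and `drift_bound` —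
  `∫|(‖Ω‖²)^p·2s⁻²σ′⟪y,Vy⟫| ≤ (4M_σ/s)√(K₁(3s)^{x₁})√(A(3s)^{1−2ρ})` (`s ≥ 1`; Cauchy–Schwarz on `B(0,3s)`, `smallMoment_trivial_bound`,
  the weighted energy and the A-gauge), `K₁ = (4π/3)^{1−2p}(16E_w)^{2p}`, `x₁ = 3(1−2p) + 2p(1−ρ)`.
The law itself (ODE comparison) is `…SmallMomentLaw`.

HONEST FRAMING: an UPPER-bound instrument at the self-similar borderline rate (SEEDS-R53 S2 — the E-budget generalisation of Chae 2007,
whose hypothesis `sup ‖DV‖ < ∞` the needle violates); it kills nothing by itself; nothing about the crux E (19832 OPEN) or NS regularity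
is proved here. [nsreg-p2 R52 §E; folklore]
-/

noncomputable section

set_option linter.dupNamespace false

open Set Filter Topology Metric Function MeasureTheory InnerProductSpace
open scoped Topology ENNReal RealInnerProductSpace

namespace Summit.NavierStokesRegularity.NavierStokesRegularity.Theorems.PowerGaugeEulerLiouville

open Literature.Analysis Literature.Analysis.FluidPDE

namespace SmallMoment

/-! ## The cut-off's scale derivative -/

/-- `σ′(t) = 0` for `t < 0` (`σ = Real.smoothTransition` is constant there). [folklore] -/
private theorem deriv_smoothTransition_eq_zero_of_neg {t : ℝ} (ht : t < 0) : deriv Real.smoothTransition t = 0 := by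
  have h : Real.smoothTransition =ᶠ[𝓝 t] fun _ => (0 : ℝ) := by
    filter_upwards [Iio_mem_nhds ht] with s hs
    exact Real.smoothTransition.zero_of_nonpos (le_of_lt hs)
  rw [h.deriv_eq, deriv_const]

/-- `σ′ ≥ 0`. [folklore] -/
private theorem deriv_smoothTransition_nonneg' (t : ℝ) : 0 ≤ deriv Real.smoothTransition t :=
  Real.smoothTransition.monotone.deriv_nonneg

/-- `σ′(2 − ‖y‖²/s²) = 0` off the closed ball `B̄(0, 2s)` (indeed off `B̄(0, √2 s)`). [folklore] -/
theorem deriv_sigma_arg_eq_zero {s : ℝ} (hs : 0 < s) {y : EuclideanSpace ℝ (Fin 3)} (hy : 2 * s < ‖y‖) :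
    deriv Real.smoothTransition (2 - (s ^ 2)⁻¹ * ‖y‖ ^ 2) = 0 := by
  apply deriv_smoothTransition_eq_zero_of_neg
  have hs2 : 0 < s ^ 2 := by positivity
  have h : (2 * s) ^ 2 < ‖y‖ ^ 2 := by gcongr
  have h4 : 4 < (s ^ 2)⁻¹ * ‖y‖ ^ 2 := by rw [lt_inv_mul_iff₀ hs2]; linarith
  linarith

/-- The scale derivative of the cut-off: `d/ds σ(2 − ‖y‖²/s²) = σ′(2 − ‖y‖²/s²)·(2‖y‖²/s³)` (`s ≠ 0`). [folklore] -/
theorem hasDerivAt_psiR_scale {s : ℝ} (hs : s ≠ 0) (y : EuclideanSpace ℝ (Fin 3)) :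
    HasDerivAt (fun s : ℝ => Real.smoothTransition (2 - (s ^ 2)⁻¹ * ‖y‖ ^ 2))
      (deriv Real.smoothTransition (2 - (s ^ 2)⁻¹ * ‖y‖ ^ 2) * (2 * ‖y‖ ^ 2 * (s ^ 3)⁻¹)) s := by
  have h1 : HasDerivAt (fun s : ℝ => (s ^ 2)⁻¹) (-2 * (s ^ 3)⁻¹) s := by
    have h := (hasDerivAt_pow 2 s).inv (pow_ne_zero 2 hs)
    refine h.congr_deriv ?_
    rw [show (2 : ℕ) - 1 = 1 from rfl, pow_one]
    push_cast
    field_simp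
  have h2 : HasDerivAt (fun s : ℝ => 2 - (s ^ 2)⁻¹ * ‖y‖ ^ 2) (2 * ‖y‖ ^ 2 * (s ^ 3)⁻¹) s :=
    ((h1.mul_const (‖y‖ ^ 2)).const_sub 2).congr_deriv (by ring)
  have h3 : HasDerivAt Real.smoothTransition (deriv Real.smoothTransition (2 - (s ^ 2)⁻¹ * ‖y‖ ^ 2))
      (2 - (s ^ 2)⁻¹ * ‖y‖ ^ 2) :=
    ((Real.smoothTransition.contDiff (n := 1)).differentiable one_ne_zero _).hasDerivAt
  exact h3.comp s h2

section Moment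

variable {f : EuclideanSpace ℝ (Fin 3) → ℝ}

/-- **`dM/ds` under the integral** for `M(s) = ∫ σ(2 − ‖y‖²/s²) f(y) dy`, `f` continuous, `s₀ > 0`:
`M′(s₀) = ∫ σ′(2 − ‖y‖²/s₀²)·(2‖y‖²/s₀³)·f(y) dy` (dominant `M_σ·2‖y‖²(s₀/2)⁻³|f|·1_{B̄(0,4s₀)}` on `s ∈ (s₀/2, 2s₀)`). [folklore] -/
theorem hasDerivAt_moment (hf : Continuous f) {s₀ : ℝ} (hs₀ : 0 < s₀) :
    HasDerivAt (fun s : ℝ => ∫ y, Real.smoothTransition (2 - (s ^ 2)⁻¹ * ‖y‖ ^ 2) * f y)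
      (∫ y, deriv Real.smoothTransition (2 - (s₀ ^ 2)⁻¹ * ‖y‖ ^ 2) * (2 * ‖y‖ ^ 2 * (s₀ ^ 3)⁻¹) * f y) s₀ := by
  obtain ⟨Mσ, hMσ0, hMσ⟩ := WeakAxisym.exists_bound_deriv_smoothTransition
  have hσc : Continuous (deriv Real.smoothTransition) :=
    (Real.smoothTransition.contDiff (n := 1)).continuous_deriv le_rfl
  have hI : Ioo (s₀ / 2) (2 * s₀) ∈ 𝓝 s₀ := Ioo_mem_nhds (by linarith) (by linarith)
  -- the integrands and the dominant
  have hFc : ∀ s : ℝ, Continuous fun y : EuclideanSpace ℝ (Fin 3) => Real.smoothTransition (2 - (s ^ 2)⁻¹ * ‖y‖ ^ 2) * f y :=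
    fun s => (WeakAxisym.contDiff_psiR s (n := 1)).continuous.mul hf
  have hF'c : ∀ s : ℝ, Continuous fun y : EuclideanSpace ℝ (Fin 3) =>
      deriv Real.smoothTransition (2 - (s ^ 2)⁻¹ * ‖y‖ ^ 2) * (2 * ‖y‖ ^ 2 * (s ^ 3)⁻¹) * f y := fun s =>
    ((hσc.comp (continuous_const.sub (continuous_const.mul (continuous_norm.pow 2)))).mul
      ((continuous_const.mul (continuous_norm.pow 2)).mul continuous_const)).mul hf
  set bound : EuclideanSpace ℝ (Fin 3) → ℝ := fun y =>
    (closedBall (0 : EuclideanSpace ℝ (Fin 3)) (4 * s₀)).indicator (fun y => Mσ * (2 * ‖y‖ ^ 2 * ((s₀ / 2) ^ 3)⁻¹) * |f y|) y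
    with hbound
  have hbound_int : Integrable bound volume := by
    rw [hbound, integrable_indicator_iff isClosed_closedBall.measurableSet]
    exact ((continuous_const.mul ((continuous_const.mul (continuous_norm.pow 2)).mul continuous_const)).mul
      hf.abs).continuousOn.integrableOn_compact (isCompact_closedBall _ _)
  refine (hasDerivAt_integral_of_dominated_loc_of_deriv_le (μ := volume)
    (F := fun (s : ℝ) (y : EuclideanSpace ℝ (Fin 3)) => Real.smoothTransition (2 - (s ^ 2)⁻¹ * ‖y‖ ^ 2) * f y)
    (F' := fun (s : ℝ) (y : EuclideanSpace ℝ (Fin 3)) =>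
      deriv Real.smoothTransition (2 - (s ^ 2)⁻¹ * ‖y‖ ^ 2) * (2 * ‖y‖ ^ 2 * (s ^ 3)⁻¹) * f y)
    (bound := bound) hI ?_ ?_ ?_ ?_ hbound_int ?_).2
  · exact Eventually.of_forall fun s => (hFc s).aestronglyMeasurable
  · exact (hFc s₀).integrable_of_hasCompactSupport ((WeakAxisym.hasCompactSupport_psiR hs₀).mul_right)
  · exact (hF'c s₀).aestronglyMeasurable
  · refine ae_of_all _ fun y s hs => ?_
    have hs0 : 0 < s := by linarith [hs.1]
    by_cases hy : 2 * s < ‖y‖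
    · rw [deriv_sigma_arg_eq_zero hs0 hy, zero_mul, zero_mul, norm_zero]
      simp only [hbound]
      exact indicator_nonneg (fun z _ => by positivity) y
    · push Not at hy
      have hyb : y ∈ closedBall (0 : EuclideanSpace ℝ (Fin 3)) (4 * s₀) := by
        rw [mem_closedBall, dist_zero_right]; linarith [hs.2]
      simp only [hbound, indicator_of_mem hyb]
      rw [Real.norm_eq_abs, abs_mul, abs_mul,
        abs_of_nonneg (deriv_smoothTransition_nonneg' _), abs_of_nonneg (by positivity : (0 : ℝ) ≤ 2 * ‖y‖ ^ 2 * (s ^ 3)⁻¹)]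
      have h3 : (s ^ 3)⁻¹ ≤ ((s₀ / 2) ^ 3)⁻¹ := by
        apply inv_anti₀ (by positivity)
        gcongr; linarith [hs.1]
      have h4 : deriv Real.smoothTransition (2 - (s ^ 2)⁻¹ * ‖y‖ ^ 2) ≤ Mσ := hMσ _
      gcongr
  · refine ae_of_all _ fun y s hs => ?_
    have hs0 : s ≠ 0 := by linarith [hs.1]
    exact (hasDerivAt_psiR_scale hs0 y).mul_const (f y)

/-- `s·M′(s) = ∫ 2s⁻²σ′(2 − ‖y‖²/s²)‖y‖²·f` (the scale derivative in flux form). [folklore] -/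
theorem scale_mul_deriv_moment_eq (f : EuclideanSpace ℝ (Fin 3) → ℝ) {s : ℝ} (hs : s ≠ 0) :
    s * ∫ y, deriv Real.smoothTransition (2 - (s ^ 2)⁻¹ * ‖y‖ ^ 2) * (2 * ‖y‖ ^ 2 * (s ^ 3)⁻¹) * f y =
      ∫ y, f y * (2 * (s ^ 2)⁻¹ * deriv Real.smoothTransition (2 - (s ^ 2)⁻¹ * ‖y‖ ^ 2) * ‖y‖ ^ 2) := by
  rw [← integral_const_mul]
  refine integral_congr_ae (ae_of_all _ fun y => ?_)
  simp only
  field_simp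

end Moment


/-! ## The profile setting: notation-free helper facts -/

section Profile

variable {γ : ℝ} {V : EuclideanSpace ℝ (Fin 3) → EuclideanSpace ℝ (Fin 3)} {P : EuclideanSpace ℝ (Fin 3) → ℝ}

/-- `√(s^x) = s^{x/2}` for `s ≥ 0`. [folklore] -/
theorem sqrt_rpow_eq {s : ℝ} (hs : 0 ≤ s) (x : ℝ) : Real.sqrt (s ^ x) = s ^ (x / 2) := by
  rw [Real.sqrt_eq_rpow, ← Real.rpow_mul hs]; ring_nf

/-- `((‖Ω‖²)^p)² = ‖Ω‖^{4p}` and `(‖Ω‖²)^p = ‖Ω‖^{2p}` bookkeeping. [folklore] -/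
theorem sq_rpow_sq_eq (a p : ℝ) (ha : 0 ≤ a) : ((a ^ 2) ^ p) ^ 2 = a ^ (4 * p) := by
  rw [← Real.rpow_natCast a 2, ← Real.rpow_mul ha, ← Real.rpow_natCast _ 2, ← Real.rpow_mul ha]
  push_cast; ring_nf

/-- `(‖Ω‖²)^p = ‖Ω‖^{2p}`. [folklore] -/
theorem sq_rpow_eq (a p : ℝ) (ha : 0 ≤ a) : (a ^ 2) ^ p = a ^ (2 * p) := by
  rw [← Real.rpow_natCast a 2, ← Real.rpow_mul ha]; push_cast; ring_nf

/-- **Cauchy–Schwarz on a ball for continuous functions**: `∫_{B} |g|·|h| ≤ √(∫_B g²)·√(∫_B h²)`. [folklore] -/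
theorem setIntegral_mul_le_sqrt_mul_sqrt {g h : EuclideanSpace ℝ (Fin 3) → ℝ} (hg : Continuous g) (hh : Continuous h)
    (hg0 : ∀ y, 0 ≤ g y) (hh0 : ∀ y, 0 ≤ h y) (R : ℝ) :
    ∫ y in ball (0 : EuclideanSpace ℝ (Fin 3)) R, g y * h y ≤
      Real.sqrt (∫ y in ball (0 : EuclideanSpace ℝ (Fin 3)) R, g y ^ 2) *
        Real.sqrt (∫ y in ball (0 : EuclideanSpace ℝ (Fin 3)) R, h y ^ 2) := by
  set μ := (volume : Measure (EuclideanSpace ℝ (Fin 3))).restrict (ball (0 : EuclideanSpace ℝ (Fin 3)) R) with hμ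
  have hint : ∀ {k : EuclideanSpace ℝ (Fin 3) → ℝ}, Continuous k → Integrable k μ := fun hk =>
    (hk.continuousOn.integrableOn_compact (isCompact_closedBall _ _)).mono_set ball_subset_closedBall
  have hgm : MemLp g (ENNReal.ofReal 2) μ := by
    rw [show ENNReal.ofReal 2 = 2 by norm_num]
    exact (memLp_two_iff_integrable_sq hg.aestronglyMeasurable).2 (hint (hg.pow 2))
  have hhm : MemLp h (ENNReal.ofReal 2) μ := by
    rw [show ENNReal.ofReal 2 = 2 by norm_num]
    exact (memLp_two_iff_integrable_sq hh.aestronglyMeasurable).2 (hint (hh.pow 2))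
  have hH := integral_mul_le_Lp_mul_Lq_of_nonneg (μ := μ) Real.HolderConjugate.two_two
    (ae_of_all _ hg0) (ae_of_all _ hh0) hgm hhm
  have e : ∀ {k : EuclideanSpace ℝ (Fin 3) → ℝ}, (∫ y, k y ^ (2 : ℝ) ∂μ) ^ (1 / (2 : ℝ)) = Real.sqrt (∫ y, k y ^ 2 ∂μ) := by
    intro k; rw [Real.sqrt_eq_rpow]; congr 1; refine integral_congr_ae (ae_of_all _ fun y => ?_); exact Real.rpow_two _
  rw [e, e] at hH
  exact hH

/-- **The stretching-term bound**: for a `C¹` field with finite weighted energy `E_w` (`0 < ρ < 1`) and `0 < p ≤ ½`, for every `s ≥ 1`,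
`∫ |ψ_s·(‖Ω‖²)^{p−1}⟪Ω,DVΩ⟫| ≤ √(K₁(3s)^{x₁})·√((3s)^{1−ρ}E_w)`, `K₁ = (4π/3)^{1−2p}(16E_w)^{2p}`, `x₁ = 3(1−2p) + 2p(1−ρ)`
(`|ψ_s(‖Ω‖²)^{p−1}⟪Ω,DVΩ⟫| ≤ 1_{B(0,3s)}(‖Ω‖²)^p‖DV‖`, Cauchy–Schwarz, `smallMoment_trivial_bound`, `setIntegral_norm_fderiv_sq_le_of_weightedEnergy`). [folklore] -/
theorem stretch_bound {ρ p : ℝ} (hρ1 : ρ < 1) (hp : 0 < p) (hp2 : p ≤ 1 / 2) (hV : ContDiff ℝ 2 V)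
    (hE : (∫⁻ y, ‖fderiv ℝ V y‖ₑ ^ 2 * ENNReal.ofReal (‖y‖ ^ (ρ - 1))) ≠ ⊤) {s : ℝ} (hs : 1 ≤ s) :
    ∫ y, |Real.smoothTransition (2 - (s ^ 2)⁻¹ * ‖y‖ ^ 2) *
        ((‖curl V y‖ ^ 2) ^ (p - 1) * ⟪curl V y, fderiv ℝ V y (curl V y)⟫)| ≤
      Real.sqrt ((Real.pi * 4 / 3) ^ (1 - 4 * p / 2) *
          (16 * (∫⁻ y, ‖fderiv ℝ V y‖ₑ ^ 2 * ENNReal.ofReal (‖y‖ ^ (ρ - 1))).toReal) ^ (4 * p / 2) *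
            (3 * s) ^ (3 * (1 - 4 * p / 2) + (1 - ρ) * (4 * p / 2))) *
        Real.sqrt ((3 * s) ^ (1 - ρ) * (∫⁻ y, ‖fderiv ℝ V y‖ₑ ^ 2 * ENNReal.ofReal (‖y‖ ^ (ρ - 1))).toReal) := by
  have hs0 : 0 < s := by linarith
  have h3s : 0 < 3 * s := by linarith
  have hV1 : ContDiff ℝ 1 V := hV.of_le (by norm_cast)
  have hΩc : Continuous (curl V) := (contDiff_one_curl hV).continuous
  have hDVc : Continuous (fderiv ℝ V) := hV.continuous_fderiv (by norm_cast)
  have htc : Continuous fun y => ‖curl V y‖ ^ 2 := hΩc.norm.pow 2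
  have hfc : Continuous fun y => (‖curl V y‖ ^ 2) ^ p := htc.rpow_const fun y => Or.inr hp.le
  -- pointwise: `|ψ_s t^{p-1} S| ≤ 1_{B(0,3s)} · t^p‖DV‖`
  have hptw : ∀ y, |Real.smoothTransition (2 - (s ^ 2)⁻¹ * ‖y‖ ^ 2) *
      ((‖curl V y‖ ^ 2) ^ (p - 1) * ⟪curl V y, fderiv ℝ V y (curl V y)⟫)| ≤
      (ball (0 : EuclideanSpace ℝ (Fin 3)) (3 * s)).indicator (fun y => (‖curl V y‖ ^ 2) ^ p * ‖fderiv ℝ V y‖) y := by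
    intro y
    have hcore : |(‖curl V y‖ ^ 2) ^ (p - 1) * ⟪curl V y, fderiv ℝ V y (curl V y)⟫| ≤ (‖curl V y‖ ^ 2) ^ p * ‖fderiv ℝ V y‖ := by
      rcases eq_or_lt_of_le (sq_nonneg ‖curl V y‖) with h0 | h0
      · have hΩ0 : curl V y = 0 := by
          have : ‖curl V y‖ = 0 := by nlinarith [norm_nonneg (curl V y), h0.symm]
          exact norm_eq_zero.1 this
        simp [hΩ0, Real.zero_rpow hp.ne']
      · rw [abs_mul, abs_of_nonneg (Real.rpow_nonneg (sq_nonneg _) _)]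
        calc (‖curl V y‖ ^ 2) ^ (p - 1) * |⟪curl V y, fderiv ℝ V y (curl V y)⟫|
            ≤ (‖curl V y‖ ^ 2) ^ (p - 1) * (‖curl V y‖ ^ 2 * ‖fderiv ℝ V y‖) :=
              mul_le_mul_of_nonneg_left (abs_inner_fderiv_apply_le y) (Real.rpow_nonneg (sq_nonneg _) _)
          _ = (‖curl V y‖ ^ 2) ^ p * ‖fderiv ℝ V y‖ := by
              have : (‖curl V y‖ ^ 2) ^ (p - 1) * ‖curl V y‖ ^ 2 = (‖curl V y‖ ^ 2) ^ p := by
                conv_lhs => rw [show (‖curl V y‖ ^ 2) ^ (p - 1) * ‖curl V y‖ ^ 2 =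
                  (‖curl V y‖ ^ 2) ^ (p - 1) * (‖curl V y‖ ^ 2) ^ (1 : ℝ) by rw [Real.rpow_one]]
                rw [← Real.rpow_add h0]; ring_nf
              rw [← mul_assoc, this]
    by_cases hy : y ∈ ball (0 : EuclideanSpace ℝ (Fin 3)) (3 * s)
    · rw [indicator_of_mem hy, abs_mul, abs_of_nonneg (WeakAxisym.psiR_nonneg s y)]
      calc Real.smoothTransition (2 - (s ^ 2)⁻¹ * ‖y‖ ^ 2) * |(‖curl V y‖ ^ 2) ^ (p - 1) * ⟪curl V y, fderiv ℝ V y (curl V y)⟫|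
          ≤ 1 * ((‖curl V y‖ ^ 2) ^ p * ‖fderiv ℝ V y‖) :=
            mul_le_mul (WeakAxisym.psiR_le_one s y) hcore (abs_nonneg _) zero_le_one
        _ = (‖curl V y‖ ^ 2) ^ p * ‖fderiv ℝ V y‖ := one_mul _
    · have hy' : 2 * s ≤ ‖y‖ := by
        rw [mem_ball_zero_iff, not_lt] at hy; linarith
      rw [WeakAxisym.psiR_eq_zero_of_le hs0 hy', zero_mul, abs_zero, indicator_of_notMem hy]
  -- integrate
  have hint : Integrable (fun y => (ball (0 : EuclideanSpace ℝ (Fin 3)) (3 * s)).indicator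
      (fun y => (‖curl V y‖ ^ 2) ^ p * ‖fderiv ℝ V y‖) y) volume := by
    rw [integrable_indicator_iff measurableSet_ball]
    exact ((hfc.mul hDVc.norm).continuousOn.integrableOn_compact (isCompact_closedBall _ _)).mono_set ball_subset_closedBall
  calc ∫ y, |Real.smoothTransition (2 - (s ^ 2)⁻¹ * ‖y‖ ^ 2) *
        ((‖curl V y‖ ^ 2) ^ (p - 1) * ⟪curl V y, fderiv ℝ V y (curl V y)⟫)|
      ≤ ∫ y, (ball (0 : EuclideanSpace ℝ (Fin 3)) (3 * s)).indicator (fun y => (‖curl V y‖ ^ 2) ^ p * ‖fderiv ℝ V y‖) y :=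
        integral_mono_of_nonneg (ae_of_all _ fun y => abs_nonneg _) hint (ae_of_all _ hptw)
    _ = ∫ y in ball (0 : EuclideanSpace ℝ (Fin 3)) (3 * s), (‖curl V y‖ ^ 2) ^ p * ‖fderiv ℝ V y‖ :=
        integral_indicator measurableSet_ball
    _ ≤ Real.sqrt (∫ y in ball (0 : EuclideanSpace ℝ (Fin 3)) (3 * s), ((‖curl V y‖ ^ 2) ^ p) ^ 2) *
          Real.sqrt (∫ y in ball (0 : EuclideanSpace ℝ (Fin 3)) (3 * s), ‖fderiv ℝ V y‖ ^ 2) :=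
        setIntegral_mul_le_sqrt_mul_sqrt hfc hDVc.norm (fun y => Real.rpow_nonneg (sq_nonneg _) _) (fun y => norm_nonneg _) _
    _ ≤ _ := by
        have hq : 0 < 4 * p := by linarith
        have hq2 : 4 * p ≤ 2 := by linarith
        have h1 := smallMoment_trivial_bound hρ1 hV1 hE hq hq2 h3s
        have h2 := setIntegral_norm_fderiv_sq_le_of_weightedEnergy hρ1 hE h3s
        have e1 : ∫ y in ball (0 : EuclideanSpace ℝ (Fin 3)) (3 * s), ((‖curl V y‖ ^ 2) ^ p) ^ 2 =
            ∫ y in ball (0 : EuclideanSpace ℝ (Fin 3)) (3 * s), ‖curl V y‖ ^ (4 * p) :=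
          integral_congr_ae (ae_of_all _ fun y => sq_rpow_sq_eq _ _ (norm_nonneg _))
        rw [e1]
        gcongr

/-- **The drift-term bound**: with the A-gauge `∫_{B_R}‖V‖² ≤ A R^{1−2ρ}` (`R ≥ 1`) and `σ′ ≤ M_σ`, for every `s ≥ 1`,
`∫ |(‖Ω‖²)^p·2s⁻²σ′(2 − ‖y‖²/s²)⟪y, V y⟫| ≤ (4M_σ/s)·√(K₁(3s)^{x₁})·√(A(3s)^{1−2ρ})`. [folklore] -/
theorem drift_bound {ρ p : ℝ} (hρ1 : ρ < 1) (hp : 0 < p) (hp2 : p ≤ 1 / 2) (hV : ContDiff ℝ 2 V)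
    (hE : (∫⁻ y, ‖fderiv ℝ V y‖ₑ ^ 2 * ENNReal.ofReal (‖y‖ ^ (ρ - 1))) ≠ ⊤)
    {A : ℝ} (hA : ∀ R : ℝ, 1 ≤ R → ∫ y in ball (0 : EuclideanSpace ℝ (Fin 3)) R, ‖V y‖ ^ 2 ≤ A * R ^ (1 - 2 * ρ))
    {Mσ : ℝ} (hMσ0 : 0 ≤ Mσ) (hMσ : ∀ t : ℝ, deriv Real.smoothTransition t ≤ Mσ) {s : ℝ} (hs : 1 ≤ s) :
    ∫ y, |(‖curl V y‖ ^ 2) ^ p *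
        (2 * (s ^ 2)⁻¹ * deriv Real.smoothTransition (2 - (s ^ 2)⁻¹ * ‖y‖ ^ 2) * ⟪y, V y⟫)| ≤
      4 * Mσ / s *
        (Real.sqrt ((Real.pi * 4 / 3) ^ (1 - 4 * p / 2) *
            (16 * (∫⁻ y, ‖fderiv ℝ V y‖ₑ ^ 2 * ENNReal.ofReal (‖y‖ ^ (ρ - 1))).toReal) ^ (4 * p / 2) *
              (3 * s) ^ (3 * (1 - 4 * p / 2) + (1 - ρ) * (4 * p / 2))) *
          Real.sqrt (A * (3 * s) ^ (1 - 2 * ρ))) := by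
  have hs0 : 0 < s := by linarith
  have h3s : 0 < 3 * s := by linarith
  have h3s1 : 1 ≤ 3 * s := by linarith
  have hV1 : ContDiff ℝ 1 V := hV.of_le (by norm_cast)
  have hVc : Continuous V := hV.continuous
  have hΩc : Continuous (curl V) := (contDiff_one_curl hV).continuous
  have htc : Continuous fun y => ‖curl V y‖ ^ 2 := hΩc.norm.pow 2
  have hfc : Continuous fun y => (‖curl V y‖ ^ 2) ^ p := htc.rpow_const fun y => Or.inr hp.le
  -- pointwise: `|f·2s⁻²σ′⟪y,Vy⟫| ≤ (4Mσ/s)·1_{B(0,3s)}·f‖V‖`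
  have hptw : ∀ y, |(‖curl V y‖ ^ 2) ^ p *
      (2 * (s ^ 2)⁻¹ * deriv Real.smoothTransition (2 - (s ^ 2)⁻¹ * ‖y‖ ^ 2) * ⟪y, V y⟫)| ≤
      4 * Mσ / s * (ball (0 : EuclideanSpace ℝ (Fin 3)) (3 * s)).indicator (fun y => (‖curl V y‖ ^ 2) ^ p * ‖V y‖) y := by
    intro y
    by_cases hy : 2 * s < ‖y‖
    · rw [deriv_sigma_arg_eq_zero hs0 hy, mul_zero, zero_mul, mul_zero, abs_zero]
      exact mul_nonneg (by positivity) (indicator_nonneg (fun z _ => by positivity) y)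
    · push Not at hy
      have hyb : y ∈ ball (0 : EuclideanSpace ℝ (Fin 3)) (3 * s) := by rw [mem_ball_zero_iff]; linarith
      rw [indicator_of_mem hyb]
      have hf0 : 0 ≤ (‖curl V y‖ ^ 2) ^ p := Real.rpow_nonneg (sq_nonneg _) _
      have hσ0 : 0 ≤ deriv Real.smoothTransition (2 - (s ^ 2)⁻¹ * ‖y‖ ^ 2) := deriv_smoothTransition_nonneg' _
      have hin : |⟪y, V y⟫| ≤ 2 * s * ‖V y‖ :=
        (abs_real_inner_le_norm y (V y)).trans (mul_le_mul_of_nonneg_right hy (norm_nonneg _))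
      rw [abs_mul, abs_of_nonneg hf0, abs_mul, abs_of_nonneg (by positivity : (0 : ℝ) ≤ 2 * (s ^ 2)⁻¹ * deriv Real.smoothTransition (2 - (s ^ 2)⁻¹ * ‖y‖ ^ 2))]
      have hc : 2 * (s ^ 2)⁻¹ * deriv Real.smoothTransition (2 - (s ^ 2)⁻¹ * ‖y‖ ^ 2) * |⟪y, V y⟫| ≤ 4 * Mσ / s * ‖V y‖ := by
        calc 2 * (s ^ 2)⁻¹ * deriv Real.smoothTransition (2 - (s ^ 2)⁻¹ * ‖y‖ ^ 2) * |⟪y, V y⟫|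
            ≤ 2 * (s ^ 2)⁻¹ * Mσ * (2 * s * ‖V y‖) := by gcongr; exact hMσ _
          _ = 4 * Mσ / s * ‖V y‖ := by field_simp; ring
      calc (‖curl V y‖ ^ 2) ^ p * (2 * (s ^ 2)⁻¹ * deriv Real.smoothTransition (2 - (s ^ 2)⁻¹ * ‖y‖ ^ 2) * |⟪y, V y⟫|)
          ≤ (‖curl V y‖ ^ 2) ^ p * (4 * Mσ / s * ‖V y‖) := mul_le_mul_of_nonneg_left hc hf0
        _ = 4 * Mσ / s * ((‖curl V y‖ ^ 2) ^ p * ‖V y‖) := by ring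
  have hint : Integrable (fun y => 4 * Mσ / s * (ball (0 : EuclideanSpace ℝ (Fin 3)) (3 * s)).indicator
      (fun y => (‖curl V y‖ ^ 2) ^ p * ‖V y‖) y) volume := by
    refine Integrable.const_mul ?_ _
    rw [integrable_indicator_iff measurableSet_ball]
    exact ((hfc.mul hVc.norm).continuousOn.integrableOn_compact (isCompact_closedBall _ _)).mono_set ball_subset_closedBall
  have hA0 : 0 ≤ A := by
    have h := hA 1 le_rfl
    rw [Real.one_rpow, mul_one] at h
    exact (integral_nonneg fun y => sq_nonneg _).trans h
  calc ∫ y, |(‖curl V y‖ ^ 2) ^ p *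
        (2 * (s ^ 2)⁻¹ * deriv Real.smoothTransition (2 - (s ^ 2)⁻¹ * ‖y‖ ^ 2) * ⟪y, V y⟫)|
      ≤ ∫ y, 4 * Mσ / s * (ball (0 : EuclideanSpace ℝ (Fin 3)) (3 * s)).indicator
          (fun y => (‖curl V y‖ ^ 2) ^ p * ‖V y‖) y :=
        integral_mono_of_nonneg (ae_of_all _ fun y => abs_nonneg _) hint (ae_of_all _ hptw)
    _ = 4 * Mσ / s * ∫ y in ball (0 : EuclideanSpace ℝ (Fin 3)) (3 * s), (‖curl V y‖ ^ 2) ^ p * ‖V y‖ := by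
        rw [integral_const_mul, integral_indicator measurableSet_ball]
    _ ≤ 4 * Mσ / s * (Real.sqrt (∫ y in ball (0 : EuclideanSpace ℝ (Fin 3)) (3 * s), ((‖curl V y‖ ^ 2) ^ p) ^ 2) *
          Real.sqrt (∫ y in ball (0 : EuclideanSpace ℝ (Fin 3)) (3 * s), ‖V y‖ ^ 2)) := by
        gcongr
        exact setIntegral_mul_le_sqrt_mul_sqrt hfc hVc.norm (fun y => Real.rpow_nonneg (sq_nonneg _) _) (fun y => norm_nonneg _) _
    _ ≤ _ := by
        have hq : 0 < 4 * p := by linarith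
        have hq2 : 4 * p ≤ 2 := by linarith
        have h1 := smallMoment_trivial_bound hρ1 hV1 hE hq hq2 h3s
        have h2 := hA (3 * s) h3s1
        have e1 : ∫ y in ball (0 : EuclideanSpace ℝ (Fin 3)) (3 * s), ((‖curl V y‖ ^ 2) ^ p) ^ 2 =
            ∫ y in ball (0 : EuclideanSpace ℝ (Fin 3)) (3 * s), ‖curl V y‖ ^ (4 * p) :=
          integral_congr_ae (ae_of_all _ fun y => sq_rpow_sq_eq _ _ (norm_nonneg _))
        rw [e1]
        gcongr

end Profile

end SmallMoment

end Summit.NavierStokesRegularity.NavierStokesRegularity.Theorems.PowerGaugeEulerLiouville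

end
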